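/-
Copyright (c) 2026 the pub-hodgecm-mathlib formalisation cell (harness21).  Prover seat hodgecm-mathlib-A-p12 (g25): road «S3-ram» (LEAD F0P3a-plan (g13); (Cnt2′) chair
F0P3a-p07 (g15) RULING (13) organ (4b), RULING (15) lock convention; (α) keeper F0P3a-p06 (g16)); organ (K4d): the lock bridge socket ↔ re-rooted literal; 2026-09-02.
-/
import Literature.NumberTheory.Automorphic.UnitaryLatticeTreeResidualTokens    -- ★ `v_lt_one_iff_of_v_sub_lt_one`
import HarnessLib

/-!
# The ramified `κ`-orbital integral, TYPE (2): THE LOCK `Λ(c)` OF THE SOCKET EQUALS THE LOCK OF THE RE-ROOTED CENTRED LITERAL (organ (K4d))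
# (Rogawski 1990 §4.9; Kottwitz 1986 §3; Labesse–Langlands 1979 §2)

Topic `NumberTheory/Rogawski1990`; namespace `Literature.NumberTheory.Rogawski1990.TypeOneRamifiedJunction`.  THEOREMS ONLY; kernel lane `--supports
stmt-HodgeConjecture-24833`; datum-free; count-neutral.  Cell `pub/hodgecm-mathlib` (D-0151), crux H413; (Cnt2′) ROUTE B.  The (α) block-law cells
`stub_Zhyp_pm_{even,odd}_B` (keeper F0P3a-p06 (g16), chair RULING (15)) key the sign of `NP − NM` on the SOCKET lock
`Λ(c) :≡ ∃ z, |z| = 1 ∧ |(tr ĝ_w − 2u_w)∕(2ϖ^m) − c·z²| < 1`, while ★ (K4b)∕(K4c) (`hyperbolicVertexCensus_*`, `regionSums_hyperbolic_of_kindCounts_of_[not_]lock`) key on the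
lock of the re-rooted centred literal `B₀ = k⁻¹(s·ĝ_w)k` (`s·u_w = 1`): `∃ a, |a| = 1 ∧ |ϖ^{−m}(½tr B₀ − 1) − c·a²| < 1`.  Since `tr B₀ = s·tr ĝ_w` (★ A-p19 (g29)
`trace_coe_inv_conj_scalar_mul`) and `s ≡ 1 (mod ϖ)`, the two agree:
* **`lock_iff_of_trace_eq_mul`** — scalar form: `tB = s·tg`, `s·u = 1`, `|u − 1| < 1`, `|(tg − 2u)∕(2ϖ^d)| ≤ 1` ⇒ the two lock statements are equivalent (same witness).
HONEST LABEL: HC_CM is proved only modulo the 2 remaining named inputs (hLiu418 24832, h413 24833) until rung 0 closes; nothing printed is asserted here.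

## References
* [Rogawski1990] J. D. Rogawski, *Automorphic Representations of Unitary Groups in Three Variables*, Ann. of Math. Stud. 123 (1990), §4.9 p. 55.
* [Kottwitz1986] R. E. Kottwitz, *Base change for unit elements of Hecke algebras*, Compositio Math. 60 (1986), §3.
* [LabesseLanglands1979] J.-P. Labesse, R. P. Langlands, *L-indistinguishability for SL(2)*, Canad. J. Math. 31 (1979), §2 Lemma 2.1.
-/

set_option autoImplicit false

noncomputable section

open scoped Valued WithZero
open Literature.NumberTheory.Automorphic Literature.NumberTheory.Automorphic.UnitaryLatticeTree

namespace Literature.NumberTheory.Rogawski1990.TypeOneRamifiedJunction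

variable {K : Type*} [Field K] [Valued K ℤᵐ⁰] {ϖ : K}

omit [Valued K ℤᵐ⁰] in
/-- The scaled scalar parts agree up to the unit `s`: `ϖ^{−d}(½·tB − 1) = s·((tg − 2u)∕(2ϖ^d))` when `tB = s·tg`, `s·u = 1` (`2 ≠ 0`, `ϖ ≠ 0`). [cite: Kottwitz1986, §3] -/
theorem inv_pow_mul_half_trace_sub_one_eq (h2 : (2 : K) ≠ 0) (hϖ0 : ϖ ≠ 0) {tB tg s u : K} (htr : tB = s * tg) (hs : s * u = 1) (d : ℕ) :
    (ϖ ^ d)⁻¹ * (tB / 2 - 1) = s * ((tg - 2 * u) / (2 * ϖ ^ d)) := by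
  have hϖd : (ϖ ^ d : K) ≠ 0 := pow_ne_zero _ hϖ0
  rw [htr, show (1 : K) = s * u from hs.symm]
  field_simp

/-- **(K4d) THE LOCK BRIDGE.**  With `tB = s·tg`, `s·u = 1`, `|u − 1| < 1` and `|(tg − 2u)∕(2ϖ^d)| ≤ 1` (`|2| = 1`):
`(∃ a, |a| = 1 ∧ |ϖ^{−d}(½tB − 1) − c·a²| < 1) ⟺ (∃ a, |a| = 1 ∧ |(tg − 2u)∕(2ϖ^d) − c·a²| < 1)` — the (K4b)∕(K4c) lock at `B₀ = k⁻¹(s·ĝ)k` (`tB = tr B₀`,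
`tg = tr ĝ`, ★ `trace_coe_inv_conj_scalar_mul`) IS the socket lock `Λ(c)` of chair RULING (15). [cite: Rogawski1990, §4.9 p. 55] [cite: LabesseLanglands1979, §2 Lemma 2.1] -/
theorem lock_iff_of_trace_eq_mul (hϖ : Valued.v ϖ = WithZero.exp (-1 : ℤ)) (h2 : Valued.v (2 : K) = 1) {tB tg s u : K} (htr : tB = s * tg) (hs : s * u = 1)
    (hu : Valued.v (u - 1) < 1) {d : ℕ} (hY : Valued.v ((tg - 2 * u) / (2 * ϖ ^ d)) ≤ 1) (c : K) :
    (∃ a : K, Valued.v a = 1 ∧ Valued.v ((ϖ ^ d)⁻¹ * (tB / 2 - 1) - c * a ^ 2) < 1) ↔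
      (∃ a : K, Valued.v a = 1 ∧ Valued.v ((tg - 2 * u) / (2 * ϖ ^ d) - c * a ^ 2) < 1) := by
  have hϖ0 : ϖ ≠ 0 := fun h0 => by rw [h0, map_zero] at hϖ; exact WithZero.coe_ne_zero hϖ.symm
  have h20 : (2 : K) ≠ 0 := fun h0 => by rw [h0, map_zero] at h2; exact zero_ne_one h2
  -- `|u| = 1`, `|s| = 1`, `|s − 1| < 1`
  have hu1 : Valued.v u = 1 := by
    have h := Valuation.map_add_eq_of_lt_left Valued.v (x := (1 : K)) (y := u - 1) (by rw [Valuation.map_one]; exact hu)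
    rw [add_sub_cancel, Valuation.map_one] at h
    exact h
  have hs1 : Valued.v s = 1 := by
    have h := congrArg Valued.v hs
    rw [map_mul, hu1, mul_one, map_one] at h
    exact h
  have hsm : Valued.v (s - 1) < 1 := by
    rw [show s - 1 = -(s * (u - 1)) by linear_combination hs, Valuation.map_neg, map_mul, hs1, one_mul]
    exact hu
  rw [inv_pow_mul_half_trace_sub_one_eq h20 hϖ0 htr hs d]
  refine exists_congr fun a => and_congr_right fun _ => v_lt_one_iff_of_v_sub_lt_one ?_
  rw [show s * ((tg - 2 * u) / (2 * ϖ ^ d)) - c * a ^ 2 - ((tg - 2 * u) / (2 * ϖ ^ d) - c * a ^ 2) = (s - 1) * ((tg - 2 * u) / (2 * ϖ ^ d)) by ring, map_mul]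
  calc Valued.v (s - 1) * Valued.v ((tg - 2 * u) / (2 * ϖ ^ d)) ≤ Valued.v (s - 1) * 1 := mul_le_mul' le_rfl hY
    _ < 1 := by rw [mul_one]; exact hsm

end Literature.NumberTheory.Rogawski1990.TypeOneRamifiedJunction

end
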